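import Mathlib
import Literature.Analysis.FluidPDE.VectorCalculus
import Literature.Analysis.FluidPDE.ClassicalSolution
import Literature.Analysis.FluidPDE.LerayHopf
import Literature.Analysis.FluidPDE.LoopCirculation
import Summits.NavierStokesRegularity.NavierStokesRegularity.Theorems.TautLoopKelvinTautLoopLawStepSpectrumTools
import Summits.NavierStokesRegularity.NavierStokesRegularity.Theorems.TautLoopKelvinTautLoopLawStepLassoQuantTools
import Summits.NavierStokesRegularity.NavierStokesRegularity.Theorems.TautLoopKelvinTautLoopLawStepOfSelectionAux
import HarnessLib

/-!
# Route `TautLoopKelvin`, crux `TautLoopLaw` (stmt-NavierStokesRegularity-15249), line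
  `Sketch-ideas-r1k1` (Dini–Saks architecture) — skeleton stub `stub_tautLoopStepOfSelection`
  (6B: the exact-level left-Dini step from the random-walk selection)

**Statement.** Write `ℓ(v, g) := inf {len γ : γ a closed C¹ loop, g ≤ |∮_γ v|} ∈ [0, ∞]`
(`len γ = ∫₀¹ ‖γ′‖`, `inf ∅ = ⊤`) and let `Λ(v, g) := ⨅_{ε>0} sSup {κ(γ) : γ admissible at level g,
len γ ≤ ℓ(v, g) + ε}` be the near-taut compression rate, `κ(γ) := (∫₀¹ −⟪γ′, Dv(γ)γ′⟫/‖γ′‖)/len γ`.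
Assume the random-walk Kelvin selection (skeleton stub 6A, taken as the first hypothesis): for
the crux's solution class, a base time `t ∈ (0, T)`, a radius `R`, a length budget `L`, a slack
`δ > 0` and an exponent `M`, every closed `C¹` loop in `B̄(0, R)` of length `≤ L` has, for all
small `h > 0`, a partner `γ'` in `B̄(0, R + 1)` with `len γ' ≤ len γ · exp(h(κ(γ) + δ))` and
`|∮_γ u(t)| − h^M ≤ |∮_{γ'} u(t − h)|`. Then for a classical solution of the unforced Navier–Stokes
system on `[0, T) × ℝ³`, Leray–Hopf from its rapidly decaying datum, a level `g > 0`, a base time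
`t ∈ (0, T)` and `η > 0`: for all small `h > 0`,
`ℓ(u(t − h), g) ≤ ℓ(u t, g) · exp(h (Λ(u t, g) + η))` in `[0, ∞]`.

**Proof.** If `ℓ(u t, g) = ⊤` there is nothing to prove. Otherwise the level-`g` class at `t` is
nonempty and, by the slab package on `[t/2, t]` (`tautLoopStepSel_slab`: `‖u‖ ≤ B₀`,
`‖Du(t)‖ ≤ B₁`, `L_c`-Lipschitz vorticity slices, decay of `u t`), `ℓ := ℓ(u t, g) ≥ g/B₀ > 0`
(`tautLoopSpec_ofReal_div_le_spectrum`). The junk guards on `Λ` (`tautLoopSpec_extraction`) give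
`ε₀ > 0` such that every admissible loop of length `≤ ℓ + ε₀` has `κ ≤ Λ + η/4`; confinement
(`tautLoopSpec_confinement`) puts every admissible loop of length `≤ ℓ + 1` in a ball `B̄(0, R)`.
Since the class is nonempty, `u t ≢ 0`, so the vorticity has uniform finite vanishing order
`c dᴺ` on `[t/2, t] × B̄(0, R + 2)` (`tautLoopStepSel_vanishing`). Apply the selection with
`(R, ℓ + 1, η/4, M := 6N + 5)`. For small `h`: pick an admissible `γ_h` with `len γ_h < ℓ + h²`
(so `κ(γ_h) ≤ Λ + η/4`, `γ_h ⊂ B̄(0, R)`); the selection gives `γ'` at time `t − h` with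
`len γ' ≤ (ℓ + h²) e^{h(Λ + η/2)}` and `|∮_{γ'} u(t−h)| ≥ |∮_{γ_h} u t| − h^M`; a quantitative lasso
(`tautLoopLassoQ_lasso_gain`) at a point within `h²` of `γ' 0` where `‖curl u(t−h)‖ ≥ c h^{2N}`
gains `≥ c h^{2N} · min(c h^{2N}/L_c, h²)²/100 ≥ h^M` (`tautLoopStepSel_lasso_threshold`) at length
cost `≤ (π + 1) h² ≤ 5h²`, restoring the exact level `g`; finally
`(ℓ + h²) e^{h(Λ + η/2)} + 5h² ≤ ℓ e^{h(Λ + η)}` (`tautLoopStepSel_length_algebra`).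
-/

noncomputable section

open Set MeasureTheory Filter Topology Function Real intervalIntegral
  Literature.Analysis.FluidPDE
open scoped ENNReal NNReal InnerProductSpace RealInnerProductSpace

namespace Summit.NavierStokesRegularity.NavierStokesRegularity.Theorems

set_option linter.dupNamespace false

local notation3 "E3" => EuclideanSpace ℝ (Fin 3)

/-- The length `∫₀¹ ‖γ′‖` of a curve read on `[0, 1]`. -/
local notation3 "len⟦" γ "⟧" => (∫ σ in (0:ℝ)..1, ‖deriv γ σ‖)

/-- The circulation–length spectrum `ℓ(v, g)`. -/
local notation3 "ℓ⟦" v ", " g "⟧" => (⨅ (γ' : ℝ → EuclideanSpace ℝ (Fin 3))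
  (_ : Literature.Analysis.FluidPDE.IsC1Loop γ' ∧
    g ≤ |Literature.Analysis.FluidPDE.circulation v γ'|),
  ENNReal.ofReal (∫ σ in (0:ℝ)..1, ‖deriv γ' σ‖))

/-- The compression `κ(γ)` of the field `v` along the curve `γ`. -/
local notation3 "κ⟦" v ", " γ "⟧" =>
  ((∫ σ in (0:ℝ)..1, -(inner ℝ (deriv γ σ) (fderiv ℝ v (γ σ) (deriv γ σ))) / ‖deriv γ σ‖) /
    (∫ σ in (0:ℝ)..1, ‖deriv γ σ‖))

/-- The near-taut compression rate `Λ(v, g)`. -/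
local notation3 "Λ⟦" v ", " g "⟧" => (⨅ ε : {ε : ℝ // 0 < ε}, sSup {k : ℝ | ∃ γ : ℝ →
  EuclideanSpace ℝ (Fin 3), Literature.Analysis.FluidPDE.IsC1Loop γ ∧
  g ≤ |Literature.Analysis.FluidPDE.circulation v γ| ∧
  ENNReal.ofReal (∫ σ in (0:ℝ)..1, ‖deriv γ σ‖) ≤ ℓ⟦v, g⟧ + ENNReal.ofReal (ε : ℝ) ∧
  k = κ⟦v, γ⟧})

/-! ## Exact-level restoration by a quantitative micro-lasso -/

/-- **Exact-level restoration.** Let `v` be `C²` with an `L_c`-Lipschitz curl of uniform finite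
vanishing order `c dᴺ` (`0 < d ≤ d₀`) around every point of `B̄(0, R + 2)`, and let `γ` be a closed
`C¹` loop in `B̄(0, R + 1)`. For `0 < h ≤ 1` with `h² ≤ d₀` and `h ≤ c · min(c/L_c, 1)²/100` there
is a closed `C¹` loop `γ'` with `|∮_γ v| + h^{6N+5} ≤ |∮_{γ'} v|` and `len γ' ≤ len γ + 5h²`: the
quantitative lasso `tautLoopLassoQ_lasso_gain` (budget `τ = h²`) at a point `x'` within `h²` of
`γ 0` with `‖curl v x'‖ ≥ c h^{2N}`, whose gain dominates `h^{6N+5}`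
(`tautLoopStepSel_lasso_threshold`) at length cost `π h² + h² ≤ 5h²`. [folklore] -/
theorem tautLoopStepSel_restore {v : E3 → E3} (hv : ContDiff ℝ 2 v) {Lc c d₀ R h : ℝ} {N : ℕ}
    (hLc : 0 < Lc) (hc : 0 < c) (hL : ∀ x y, ‖curl v x - curl v y‖ ≤ Lc * ‖x - y‖)
    (hvan : ∀ x : E3, ‖x‖ ≤ R + 2 → ∀ d : ℝ, 0 < d → d ≤ d₀ →
      ∃ x' : E3, ‖x' - x‖ ≤ d ∧ c * d ^ N ≤ ‖curl v x'‖)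
    (hh : 0 < h) (hh1 : h ≤ 1) (hhd : h ^ 2 ≤ d₀) (hhG : h ≤ c * (min (c / Lc) 1) ^ 2 / 100)
    {γ : ℝ → E3} (hγ : IsC1Loop γ) (hγR : ∀ σ, ‖γ σ‖ ≤ R + 1) :
    ∃ γ' : ℝ → E3, IsC1Loop γ' ∧ |circulation v γ| + h ^ (6 * N + 5) ≤ |circulation v γ'| ∧
      len⟦γ'⟧ ≤ len⟦γ⟧ + 5 * h ^ 2 := by
  have hh2 : 0 < h ^ 2 := by positivity
  obtain ⟨x', hx', hw⟩ := hvan (γ 0) (by linarith [hγR 0]) (h ^ 2) hh2 hhd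
  have hw0 : 0 < c * (h ^ 2) ^ N := by positivity
  have hdist : dist x' (γ 0) ≤ h ^ 2 := by rwa [dist_eq_norm]
  obtain ⟨Λ, hΛ, hgain, hlen⟩ := tautLoopLassoQ_lasso_gain hv hw0 hh2 hLc hL hγ hdist hw
  refine ⟨Λ, hΛ, ?_, ?_⟩
  · have hthr := tautLoopStepSel_lasso_threshold c Lc h N hc hLc hh hh1 hhG
    linarith
  · have hπ : π * h ^ 2 ≤ 4 * h ^ 2 := by nlinarith [Real.pi_lt_four]
    linarith

/-! ## The step at an abstract finite spectrum value -/

/-- **The core of the exact-level step.** Abstract form of the step at a base time `t` for a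
time-dependent field `u`, a level `g > 0` and a finite positive spectrum value `ℓ = Er`: given
near-taut admissible loops (`len < Er + ε` for every `ε > 0`), the junk-guarded extraction
(`len ≤ Er + ε₀ ⇒ κ ≤ Λ + η/4`), confinement of admissible loops of length `≤ Er + 1` to
`B̄(0, R)`, the random-walk selection at `(R, Er + 1, η/4, 6N + 5)`, `C²` slices with
`L_c`-Lipschitz curls on `[t/2, t]` and the uniform vanishing order `c dᴺ` of the curls on
`[t/2, t] × B̄(0, R + 2)`, there is `h₀ > 0` such that for every `h ∈ (0, h₀)` some closed `C¹`
loop at level `g` for `u (t − h)` has length `≤ Er · exp(h(Λ + η))`. [folklore] -/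
theorem tautLoopStepSel_core {u : ℝ → E3 → E3} {t g η Er Λr ε₀ R h₁ Lc c d₀ : ℝ} {N : ℕ}
    (ht : 0 < t) (hη : 0 < η) (hEr : 0 < Er) (hε₀ : 0 < ε₀) (hh₁ : 0 < h₁)
    (hLc : 0 < Lc) (hc : 0 < c) (hd₀ : 0 < d₀)
    (hnear : ∀ ε : ℝ, 0 < ε → ∃ γ : ℝ → E3, IsC1Loop γ ∧ g ≤ |circulation (u t) γ| ∧
      len⟦γ⟧ < Er + ε)
    (hext : ∀ γ : ℝ → E3, IsC1Loop γ → g ≤ |circulation (u t) γ| → len⟦γ⟧ ≤ Er + ε₀ →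
      κ⟦u t, γ⟧ ≤ Λr + η / 4)
    (hconf : ∀ γ : ℝ → E3, IsC1Loop γ → g ≤ |circulation (u t) γ| → len⟦γ⟧ ≤ Er + 1 →
      ∀ σ, ‖γ σ‖ ≤ R)
    (hsel : ∀ h : ℝ, 0 < h → h < h₁ → ∀ γ : ℝ → E3, IsC1Loop γ → (∀ σ, ‖γ σ‖ ≤ R) →
      len⟦γ⟧ ≤ Er + 1 → ∃ γ' : ℝ → E3, IsC1Loop γ' ∧ (∀ σ, ‖γ' σ‖ ≤ R + 1) ∧
        len⟦γ'⟧ ≤ len⟦γ⟧ * Real.exp (h * (κ⟦u t, γ⟧ + η / 4)) ∧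
        |circulation (u t) γ| - h ^ (6 * N + 5) ≤ |circulation (u (t - h)) γ'|)
    (hC2 : ∀ s ∈ Icc (t / 2) t, ContDiff ℝ 2 (u s))
    (hLip : ∀ s ∈ Icc (t / 2) t, ∀ x y : E3, ‖curl (u s) x - curl (u s) y‖ ≤ Lc * ‖x - y‖)
    (hvan : ∀ s ∈ Icc (t / 2) t, ∀ x : E3, ‖x‖ ≤ R + 2 → ∀ d : ℝ, 0 < d → d ≤ d₀ →
      ∃ x' : E3, ‖x' - x‖ ≤ d ∧ c * d ^ N ≤ ‖curl (u s) x'‖) :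
    ∃ h₀ : ℝ, 0 < h₀ ∧ ∀ h ∈ Ioo 0 h₀, ∃ γ : ℝ → E3, IsC1Loop γ ∧
      g ≤ |circulation (u (t - h)) γ| ∧ len⟦γ⟧ ≤ Er * Real.exp (h * (Λr + η)) := by
  -- the thresholds
  set hA : ℝ := Er * η / (2 * (1 + 5 * Real.exp |Λr|)) with hA_def
  set hG : ℝ := c * (min (c / Lc) 1) ^ 2 / 100 with hG_def
  set hS : ℝ := Real.sqrt (min ε₀ d₀) with hS_def
  have hA0 : 0 < hA := by positivity
  have hG0 : 0 < hG := by
    have : 0 < min (c / Lc) 1 := lt_min (div_pos hc hLc) one_pos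
    positivity
  have hS0 : 0 < hS := Real.sqrt_pos.2 (lt_min hε₀ hd₀)
  refine ⟨min (min (min h₁ (t / 2)) (min 1 hS)) (min hG hA), by positivity, ?_⟩
  rintro h ⟨hh0, hhlt⟩
  simp only [lt_min_iff] at hhlt
  obtain ⟨⟨⟨hhh₁, hht⟩, hh1, hhS⟩, hhG, hhA⟩ := hhlt
  have hsq : h ^ 2 < min ε₀ d₀ := (Real.lt_sqrt hh0.le).1 hhS
  have hε : h ^ 2 ≤ ε₀ := (hsq.trans_le (min_le_left _ _)).le
  have hd : h ^ 2 ≤ d₀ := (hsq.trans_le (min_le_right _ _)).le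
  have hh2 : 0 < h ^ 2 := by positivity
  have hh21 : h ^ 2 ≤ 1 := by nlinarith
  -- (a) a near-taut admissible loop at time `t`
  obtain ⟨γ, hγ, hγg, hγlen⟩ := hnear (h ^ 2) hh2
  have hlen0 : 0 ≤ len⟦γ⟧ := intervalIntegral.integral_nonneg zero_le_one fun σ _ => norm_nonneg _
  have hγlen1 : len⟦γ⟧ ≤ Er + 1 := by linarith
  have hκ : κ⟦u t, γ⟧ ≤ Λr + η / 4 := hext γ hγ hγg (by linarith)
  have hγR : ∀ σ, ‖γ σ‖ ≤ R := hconf γ hγ hγg hγlen1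
  -- (b) the selection at time `t - h`
  obtain ⟨γ', hγ', hγ'R, hγ'len, hγ'circ⟩ := hsel h hh0 hhh₁ γ hγ hγR hγlen1
  have hγ'len2 : len⟦γ'⟧ ≤ (Er + h ^ 2) * Real.exp (h * (Λr + η / 2)) := by
    refine hγ'len.trans (mul_le_mul hγlen.le (Real.exp_le_exp.2 ?_) (Real.exp_pos _).le
      (by linarith))
    nlinarith
  -- (c) exact-level restoration at time `t - h`
  have hs : t - h ∈ Icc (t / 2) t := ⟨by linarith, by linarith⟩
  obtain ⟨γ'', hγ'', hgain, hlen''⟩ := tautLoopStepSel_restore (hC2 _ hs) hLc hc (hLip _ hs)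
    (hvan _ hs) hh0 hh1.le hd hhG.le hγ' hγ'R
  refine ⟨γ'', hγ'', by linarith, ?_⟩
  -- (d) the length bookkeeping
  calc len⟦γ''⟧ ≤ len⟦γ'⟧ + 5 * h ^ 2 := hlen''
    _ ≤ (Er + h ^ 2) * Real.exp (h * (Λr + η / 2)) + 5 * h ^ 2 := by linarith
    _ ≤ Er * Real.exp (h * (Λr + η)) :=
        tautLoopStepSel_length_algebra Er η Λr h hEr hη hh0 hh1.le hhA.le

/-! ## The registered skeleton stub -/

/-- **Skeleton stub 6B `stub_tautLoopStepOfSelection` (the exact-level left-Dini step from the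
random-walk selection).** Given the random-walk Kelvin selection (first hypothesis), for a
classical solution of the unforced Navier–Stokes system on `[0, T) × ℝ³`, Leray–Hopf from its
rapidly decaying datum, a level `g > 0`, a base time `t ∈ (0, T)` and `η > 0`: for all small
`h > 0`, `ℓ(u(t − h), g) ≤ ℓ(u t, g) · exp(h (Λ(u t, g) + η))` in `[0, ∞]` (junk guards on `Λ`,
confinement, super-polynomial selection with `M := 6N + 5`, analyticity-fed quantitative
micro-lasso, exp-algebra; see the module docstring). [folklore] -/
theorem stub_tautLoopStepOfSelection :
    (∀ (ν T : ℝ), 0 < ν → 0 < T → ∀ (u : ℝ → EuclideanSpace ℝ (Fin 3) → EuclideanSpace ℝ (Fin 3))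
    (p : ℝ → EuclideanSpace ℝ (Fin 3) → ℝ), Literature.Analysis.FluidPDE.IsClassicalNSSolutionOn
    (Set.Ico 0 T) ν 0 u p → Literature.Analysis.FluidPDE.IsLerayHopfOn T ν 0 (u 0) u →
    Literature.Analysis.FluidPDE.HasRapidSpatialDecay (u 0) → ∀ t : ℝ, 0 < t → t < T → ∀ R L δ :
    ℝ, ∀ M : ℕ, 0 < R → 0 < L → 0 < δ → ∃ h₀ : ℝ, 0 < h₀ ∧ ∀ h : ℝ, 0 < h → h < h₀ → ∀ γ : ℝ →
    EuclideanSpace ℝ (Fin 3), Literature.Analysis.FluidPDE.IsC1Loop γ → (∀ σ, ‖γ σ‖ ≤ R) → (∫ σ in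
    (0:ℝ)..1, ‖deriv γ σ‖) ≤ L → ∃ γ' : ℝ → EuclideanSpace ℝ (Fin 3),
    Literature.Analysis.FluidPDE.IsC1Loop γ' ∧ (∀ σ, ‖γ' σ‖ ≤ R + 1) ∧ (∫ σ in (0:ℝ)..1, ‖deriv γ'
    σ‖) ≤ (∫ σ in (0:ℝ)..1, ‖deriv γ σ‖) * Real.exp (h * (((∫ σ in (0:ℝ)..1, -(inner ℝ (deriv γ σ)
    (fderiv ℝ (u t) (γ σ) (deriv γ σ))) / ‖deriv γ σ‖) / (∫ σ in (0:ℝ)..1, ‖deriv γ σ‖)) + δ)) ∧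
    |Literature.Analysis.FluidPDE.circulation (u t) γ| - h ^ M ≤
    |Literature.Analysis.FluidPDE.circulation (u (t - h)) γ'|) → ∀ (ν T : ℝ), 0 < ν → 0 < T → ∀ (u
    : ℝ → EuclideanSpace ℝ (Fin 3) → EuclideanSpace ℝ (Fin 3)) (p : ℝ → EuclideanSpace ℝ (Fin 3) →
    ℝ), Literature.Analysis.FluidPDE.IsClassicalNSSolutionOn (Set.Ico 0 T) ν 0 u p →
    Literature.Analysis.FluidPDE.IsLerayHopfOn T ν 0 (u 0) u →
    Literature.Analysis.FluidPDE.HasRapidSpatialDecay (u 0) → ∀ g : ℝ, 0 < g → ∀ t : ℝ, 0 < t → t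
    < T → ∀ η : ℝ, 0 < η → ∀ᶠ h in nhdsWithin (0:ℝ) (Set.Ioi 0), (⨅ (γ' : ℝ → EuclideanSpace ℝ
    (Fin 3)) (_ : Literature.Analysis.FluidPDE.IsC1Loop γ' ∧ g ≤
    |Literature.Analysis.FluidPDE.circulation (u (t - h)) γ'|), ENNReal.ofReal (∫ σ in (0:ℝ)..1,
    ‖deriv γ' σ‖)) ≤ (⨅ (γ' : ℝ → EuclideanSpace ℝ (Fin 3)) (_ :
    Literature.Analysis.FluidPDE.IsC1Loop γ' ∧ g ≤ |Literature.Analysis.FluidPDE.circulation (u t)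
    γ'|), ENNReal.ofReal (∫ σ in (0:ℝ)..1, ‖deriv γ' σ‖)) * ENNReal.ofReal (Real.exp (h * ((⨅ ε :
    {ε : ℝ // 0 < ε}, sSup {k : ℝ | ∃ γ : ℝ → EuclideanSpace ℝ (Fin 3),
    Literature.Analysis.FluidPDE.IsC1Loop γ ∧ g ≤ |Literature.Analysis.FluidPDE.circulation (u t)
    γ| ∧ ENNReal.ofReal (∫ σ in (0:ℝ)..1, ‖deriv γ σ‖) ≤ (⨅ (γ' : ℝ → EuclideanSpace ℝ (Fin 3)) (_
    : Literature.Analysis.FluidPDE.IsC1Loop γ' ∧ g ≤ |Literature.Analysis.FluidPDE.circulation (u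
    t) γ'|), ENNReal.ofReal (∫ σ in (0:ℝ)..1, ‖deriv γ' σ‖)) + ENNReal.ofReal (ε : ℝ) ∧ k = ((∫ σ
    in (0:ℝ)..1, -(inner ℝ (deriv γ σ) (fderiv ℝ (u t) (γ σ) (deriv γ σ))) / ‖deriv γ σ‖) / (∫ σ
    in (0:ℝ)..1, ‖deriv γ σ‖))}) + η))) := by
  intro hSel ν T hν hT u p hcl hLH hdec g hg t ht htT η hη
  -- STEP 0: the `⊤`-slice is trivial
  by_cases hEtop : ℓ⟦u t, g⟧ = ⊤
  · refine Eventually.of_forall fun h => ?_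
    rw [hEtop, ENNReal.top_mul (ENNReal.ofReal_pos.2 (Real.exp_pos _)).ne']
    exact le_top
  -- the level-`g` class at time `t` is nonempty
  have hne : ∃ γ : ℝ → E3, IsC1Loop γ ∧ g ≤ |circulation (u t) γ| := by
    by_contra h0
    push Not at h0
    refine hEtop (iInf_eq_top.2 fun γ => iInf_eq_top.2 fun hγ => ?_)
    exact absurd hγ.2 (not_le.2 (h0 γ hγ.1))
  -- STEP 1: the slab package on `[t/2, t]`
  obtain ⟨B₀, B₁, Lc, hB₀, hB₁, hLc, hbd0, hbd1, hC2, hLip, hfar⟩ :=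
    tautLoopStepSel_slab hν hT hcl hLH hdec ht htT
  have htI : t ∈ Icc (t / 2) t := ⟨by linarith, le_rfl⟩
  have hcont : Continuous (u t) := (hC2 t htI).continuous
  have hC1 : ContDiff ℝ 1 (u t) := (hC2 t htI).of_le one_le_two
  -- STEP 2: positivity of the spectrum
  have hpos : ENNReal.ofReal (g / B₀) ≤ ℓ⟦u t, g⟧ :=
    tautLoopSpec_ofReal_div_le_spectrum (u t) B₀ g hB₀ hg hcont (hbd0 t htI)
  -- STEP 3: junk guards on `Λ` (extraction of near-taut loops)
  obtain ⟨ε₀, hε₀, hext⟩ :=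
    tautLoopSpec_extraction (u t) B₁ g hB₁ hg hC1 hbd1 hne (η / 4) (by positivity)
  -- near-taut admissible loops exist at every positive slack
  have hnear : ∀ ε' : ℝ≥0∞, ε' ≠ 0 → ∃ γ : ℝ → E3, IsC1Loop γ ∧ g ≤ |circulation (u t) γ| ∧
      ENNReal.ofReal len⟦γ⟧ < ℓ⟦u t, g⟧ + ε' := by
    intro ε' hε'
    obtain ⟨γ, hγ⟩ := iInf_lt_iff.1 (ENNReal.lt_add_right hEtop hε')
    obtain ⟨hγP, hγlt⟩ := iInf_lt_iff.1 hγ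
    exact ⟨γ, hγP.1, hγP.2, hγlt⟩
  -- pass to the real values `Er` of the spectrum and `Λr` of the compression rate
  generalize Λ⟦u t, g⟧ = Λr at hext ⊢
  generalize hEeq : ℓ⟦u t, g⟧ = E at hEtop hpos hext hnear ⊢
  set Er : ℝ := E.toReal with hEr_def
  have hEeq' : E = ENNReal.ofReal Er := (ENNReal.ofReal_toReal hEtop).symm
  have hErpos : 0 < Er :=
    (div_pos hg hB₀).trans_le ((ENNReal.ofReal_le_iff_le_toReal hEtop).1 hpos)
  have hnear' : ∀ ε : ℝ, 0 < ε → ∃ γ : ℝ → E3, IsC1Loop γ ∧ g ≤ |circulation (u t) γ| ∧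
      len⟦γ⟧ < Er + ε := by
    intro ε hε
    obtain ⟨γ, hγ, hγg, hlt⟩ := hnear (ENNReal.ofReal ε) (ENNReal.ofReal_pos.2 hε).ne'
    refine ⟨γ, hγ, hγg, ?_⟩
    rw [hEeq', ← ENNReal.ofReal_add hErpos.le hε.le] at hlt
    exact (ENNReal.ofReal_lt_ofReal_iff (by positivity)).1 hlt
  have hext' : ∀ γ : ℝ → E3, IsC1Loop γ → g ≤ |circulation (u t) γ| → len⟦γ⟧ ≤ Er + ε₀ →
      κ⟦u t, γ⟧ ≤ Λr + η / 4 := fun γ hγ hγg hlen => hext γ hγ hγg (by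
    rw [hEeq', ← ENNReal.ofReal_add hErpos.le hε₀.le]
    exact ENNReal.ofReal_le_ofReal hlen)
  -- STEP 4: confinement of admissible loops of length `≤ Er + 1`
  obtain ⟨R₀, hR₀⟩ := hfar (g / (2 * (Er + 2))) (by positivity)
  have hgap : g / (2 * (Er + 2)) * (Er + 1) < g := by
    rw [div_mul_eq_mul_div, div_lt_iff₀ (by positivity)]
    nlinarith
  set R : ℝ := max (R₀ + (Er + 1)) 1 with hR_def
  have hR : 0 < R := lt_of_lt_of_le one_pos (le_max_right _ _)
  have hconf : ∀ γ : ℝ → E3, IsC1Loop γ → g ≤ |circulation (u t) γ| → len⟦γ⟧ ≤ Er + 1 →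
      ∀ σ, ‖γ σ‖ ≤ R := fun γ hγ hγg hlen σ =>
    (tautLoopSpec_confinement hcont hR₀ hgap hγ hγg hlen σ).trans (le_max_left _ _)
  -- STEP 5: uniform finite vanishing order of the vorticity on `[t/2, t] × B̄(0, R + 2)`
  have hne' : ∃ x, u t x ≠ 0 := by
    by_contra h0
    push Not at h0
    obtain ⟨γ, -, hγg⟩ := hne
    have hut : u t = 0 := funext h0
    rw [hut, circulation_zero_left, abs_zero] at hγg
    exact absurd hγg (not_le.2 hg)
  obtain ⟨N, c, hc, d₀, hd₀, hvan⟩ :=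
    tautLoopStepSel_vanishing hν hT hcl hLH hdec ht htT hne' (R := R + 2) (by positivity)
  -- STEP 6: the random-walk selection at `(R, Er + 1, η/4, 6N + 5)`
  obtain ⟨h₁, hh₁, hsel⟩ := hSel ν T hν hT u p hcl hLH hdec t ht htT R (Er + 1) (η / 4)
    (6 * N + 5) hR (by positivity) (by positivity)
  -- STEP 7: the core step, then back to `ℝ≥0∞`
  obtain ⟨h₀, hh₀, hcore⟩ := tautLoopStepSel_core ht hη hErpos hε₀ hh₁ hLc hc hd₀ hnear' hext'
    hconf hsel hC2 hLip hvan
  filter_upwards [Ioo_mem_nhdsGT hh₀] with h hh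
  obtain ⟨γ, hγ, hγg, hlen⟩ := hcore h hh
  calc ℓ⟦u (t - h), g⟧ ≤ ENNReal.ofReal len⟦γ⟧ := iInf₂_le γ ⟨hγ, hγg⟩
    _ ≤ ENNReal.ofReal (Er * Real.exp (h * (Λr + η))) := ENNReal.ofReal_le_ofReal hlen
    _ = E * ENNReal.ofReal (Real.exp (h * (Λr + η))) := by
        rw [ENNReal.ofReal_mul hErpos.le, ← hEeq']

end Summit.NavierStokesRegularity.NavierStokesRegularity.Theorems

end
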